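import Mathlib
import HarnessLib

/-!
# Route `UnitScaleTilt`, crux K1 «MinimiserStabilityRegPr» (stmt-QuantumFields-19200), route-R E′ (A′)-on-Σ, P-A2 (β), row «(n3)-comb» `hMcomb` —
# lane (II) file F-6d-2b «THE CELL KNIT, ABSTRACT FORM»: the per-corner row of w3-19200 g13's F-6c-3d read as a POSITIVE LINEAR FORM in twelve box-functional atoms; summing it over the
# level-k period cell and bounding each atom's cell total gives the same form in the cell totals — pure real bookkeeping, the shape of F-6c-3d's right side reproduced token for token

Cell `ym3-torus` (HUMAN RULING D-0037: YM₃ on the torus is ladder rung R3 — not d = 4, not a mass gap, not Clay), D-0154 (3c) R3 twin-width seat `ym-routeR-w6` (gen 9);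
★routeR-w1 g9 PENS ROUND 4 (2026-08-29 08:50:39Z) «F-6d Σ OVER CORNERS + MULTIPLICITIES + TRANSFER KNIT → routeR-w6».  `--supports stmt-QuantumFields-19200 --as helper`; THEOREMS ONLY
(0 `def`, 0 `sorry`); count-neutral.  «(O2) groundwork — route-internal row (n3)-comb, NOT N06, NOT a print row; OPEN».  Nothing of `hMcomb`, `hMcomb₂`, (β), `hPA2`, `hcoS`, E′, EX,
the stub, the crux, d = 4 or the gap is claimed.

THE POINT.  F-6c-3d ★`normSq_covGrad_gauge_le_of_stepMean` (w3-19200 g13) bounds the covariant coarse gradient of the accumulated comb gauge function at one level-`(k′+1)` corner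
`(z, κ)` by `3·( d·W_top·Σ_μ (c₁·(c₂·Tg + c₃·Tm)) + 2d·c_L·Σ_{j<k′} sw_j·w_j·Σ_μ (c1_j·(Ld·(cg·Eg_j + Cm_j·Em_j) + cd·Ed_j) + c1_j·(…′…)) + 2c_L·Σ_{i≤k′} so_i·((cO·Og_i + cO′_i·Om_i) + (…′…)) )`,
where the twelve ATOMS `Tg Tm Eg Em Ed Og Om` (and the primed ones at the neighbour `z + e_κ`) are explicit box sums of the level fields at the corner chain (top pair, cubes, defect blocks,
oscillation blocks) and every coefficient is a nonnegative closed constant in `(d, L, N, n)` or a level weight.  F-6d sums this over the cell `z = boxVec N′ z₀`, `κ`.  This file does the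
summation ABSTRACTLY: for arbitrary real atom families indexed by `(level, z₀, κ, μ)` and nonnegative coefficients, `Σ_{z₀,κ}` of the form equals the same form in the atoms' cell totals
(linearity; two `Finset.sum_comm` for the level sums), and is therefore bounded by the same form in ANY upper bounds of those totals (monotonicity).  F-6d-3 instantiates the atoms with the
covariant gradient ∕ mass ∕ defect densities and discharges the totals by F-6d-1∕F-6d-2a (`= L·GRADcell`, `= d·MASScell`, `≤ Aᵈ·cell`, `A ∈ {1, 2}`).

WHAT IS PROVED (ns `…Theorems.Prop7CornerCombCellKnitAbstract`; any finite index types `Z` (cell) and `K` (directions∕components)).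
* §1 `sum_sum_linForm_eq` — `Σ_{z,κ}` of the form = the form in the cell totals (equality).
* §2 ★★ `sum_sum_linForm_le` — … ≤ the form in any upper bounds of the cell totals, all coefficients `≥ 0`.
HONEST SCOPE.  Finite sums of reals; no lattice object.  Rung R3, not Clay; YM gap NOT proved.

References: T. Bałaban, CMP **98** (1985) 17–51 [Balaban1985Averaging] ((125)–(126) p.36: sums over blocks of blocks, level by level); CMP **95** (1984) 17–40 [Balaban1984PropagatorsI]
((1.18)–(1.20) pp.19–20).
-/

set_option autoImplicit false

noncomputable section

open scoped BigOperators

namespace Summit.QuantumFields.YangMills.Theorems.Prop7CornerCombCellKnitAbstract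

open Finset

variable {Z K : Type*} [Fintype Z] [Fintype K]

/-! ## §0 Two commuting lemmas -/

/-- `Σ_z Σ_κ (c · Σ_{j ∈ s} F j z κ) = Σ_{j ∈ s} Σ_z Σ_κ (c · F j z κ)` — a constant and a level sum pulled through the cell sum. [folklore] -/
theorem sum_sum_const_mul_sum_comm (c : ℝ) (s : Finset ℕ) (F : ℕ → Z → K → ℝ) :
    ∑ z : Z, ∑ κ : K, c * ∑ j ∈ s, F j z κ = ∑ j ∈ s, ∑ z : Z, ∑ κ : K, c * F j z κ := by
  calc _ = ∑ z : Z, ∑ κ : K, ∑ j ∈ s, c * F j z κ := by simp only [Finset.mul_sum]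
    _ = ∑ z : Z, ∑ j ∈ s, ∑ κ : K, c * F j z κ := Finset.sum_congr rfl fun z _ => Finset.sum_comm
    _ = _ := Finset.sum_comm

/-! ## §1 Linearity: the cell sum of the form is the form in the cell totals -/

/-- **LINEARITY OF THE PER-CORNER FORM UNDER THE CELL SUM**: with atoms `Tg Tm : Z → K → K → ℝ`, `Eg Em Ed Eg′ Em′ Ed′ : ℕ → Z → K → K → ℝ`, `Og Om Og′ Om′ : ℕ → Z → K → ℝ` and real
coefficients, `Σ_{z} Σ_{κ} [3·(dd·Wt·Σ_μ (c₁·(c₂·Tg + c₃·Tm)) + 2·dd·cL·Σ_{j<k′} sw j·w j·Σ_μ(…) + 2·cL·Σ_{i<k′+1} so i·(…))]` equals the same expression with every atom replaced by its cell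
total `Σ_z Σ_κ Σ_μ (·)` (resp. `Σ_z Σ_κ (·)` for the oscillation atoms). [cite: Balaban1985Averaging, (125)-(126) p.36] -/
theorem sum_sum_linForm_eq (k' : ℕ) (dd Wt c₁ c₂ c₃ cL Ld cg cd cO : ℝ) (sw w c1 Cm so cO' : ℕ → ℝ)
    (Tg Tm : Z → K → K → ℝ) (Eg Em Ed Eg' Em' Ed' : ℕ → Z → K → K → ℝ) (Og Om Og' Om' : ℕ → Z → K → ℝ) :
    ∑ z : Z, ∑ κ : K,
      3 * (dd * Wt * ∑ μ : K, (c₁ * (c₂ * Tg z κ μ + c₃ * Tm z κ μ))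
        + 2 * dd * cL * ∑ j ∈ range k', sw j * w j * ∑ μ : K,
            (c1 j * (Ld * (cg * Eg j z κ μ + Cm j * Em j z κ μ) + cd * Ed j z κ μ)
              + c1 j * (Ld * (cg * Eg' j z κ μ + Cm j * Em' j z κ μ) + cd * Ed' j z κ μ))
        + 2 * cL * ∑ i ∈ range (k' + 1), so i *
            ((cO * Og i z κ + cO' i * Om i z κ) + (cO * Og' i z κ + cO' i * Om' i z κ)))
    = 3 * (dd * Wt * (c₁ * (c₂ * (∑ z : Z, ∑ κ : K, ∑ μ : K, Tg z κ μ) + c₃ * (∑ z : Z, ∑ κ : K, ∑ μ : K, Tm z κ μ)))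
        + 2 * dd * cL * ∑ j ∈ range k', sw j * w j *
            (c1 j * (Ld * (cg * (∑ z : Z, ∑ κ : K, ∑ μ : K, Eg j z κ μ) + Cm j * (∑ z : Z, ∑ κ : K, ∑ μ : K, Em j z κ μ))
                + cd * (∑ z : Z, ∑ κ : K, ∑ μ : K, Ed j z κ μ))
              + c1 j * (Ld * (cg * (∑ z : Z, ∑ κ : K, ∑ μ : K, Eg' j z κ μ) + Cm j * (∑ z : Z, ∑ κ : K, ∑ μ : K, Em' j z κ μ))
                + cd * (∑ z : Z, ∑ κ : K, ∑ μ : K, Ed' j z κ μ)))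
        + 2 * cL * ∑ i ∈ range (k' + 1), so i *
            ((cO * (∑ z : Z, ∑ κ : K, Og i z κ) + cO' i * (∑ z : Z, ∑ κ : K, Om i z κ))
              + (cO * (∑ z : Z, ∑ κ : K, Og' i z κ) + cO' i * (∑ z : Z, ∑ κ : K, Om' i z κ)))) := by
  -- the three groups separately
  have hT : ∑ z : Z, ∑ κ : K, (dd * Wt * ∑ μ : K, (c₁ * (c₂ * Tg z κ μ + c₃ * Tm z κ μ)))
      = dd * Wt * (c₁ * (c₂ * (∑ z : Z, ∑ κ : K, ∑ μ : K, Tg z κ μ) + c₃ * (∑ z : Z, ∑ κ : K, ∑ μ : K, Tm z κ μ))) := by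
    simp only [Finset.mul_sum, Finset.sum_add_distrib, mul_add]
  have hJ : ∑ z : Z, ∑ κ : K, (2 * dd * cL * ∑ j ∈ range k', sw j * w j * ∑ μ : K,
            (c1 j * (Ld * (cg * Eg j z κ μ + Cm j * Em j z κ μ) + cd * Ed j z κ μ)
              + c1 j * (Ld * (cg * Eg' j z κ μ + Cm j * Em' j z κ μ) + cd * Ed' j z κ μ)))
      = 2 * dd * cL * ∑ j ∈ range k', sw j * w j *
            (c1 j * (Ld * (cg * (∑ z : Z, ∑ κ : K, ∑ μ : K, Eg j z κ μ) + Cm j * (∑ z : Z, ∑ κ : K, ∑ μ : K, Em j z κ μ))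
                + cd * (∑ z : Z, ∑ κ : K, ∑ μ : K, Ed j z κ μ))
              + c1 j * (Ld * (cg * (∑ z : Z, ∑ κ : K, ∑ μ : K, Eg' j z κ μ) + Cm j * (∑ z : Z, ∑ κ : K, ∑ μ : K, Em' j z κ μ))
                + cd * (∑ z : Z, ∑ κ : K, ∑ μ : K, Ed' j z κ μ))) := by
    rw [sum_sum_const_mul_sum_comm]
    simp only [Finset.mul_sum, Finset.sum_add_distrib, mul_add]
  have hO : ∑ z : Z, ∑ κ : K, (2 * cL * ∑ i ∈ range (k' + 1), so i *
            ((cO * Og i z κ + cO' i * Om i z κ) + (cO * Og' i z κ + cO' i * Om' i z κ)))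
      = 2 * cL * ∑ i ∈ range (k' + 1), so i *
            ((cO * (∑ z : Z, ∑ κ : K, Og i z κ) + cO' i * (∑ z : Z, ∑ κ : K, Om i z κ))
              + (cO * (∑ z : Z, ∑ κ : K, Og' i z κ) + cO' i * (∑ z : Z, ∑ κ : K, Om' i z κ))) := by
    rw [sum_sum_const_mul_sum_comm]
    simp only [Finset.mul_sum, Finset.sum_add_distrib, mul_add]
  rw [← hT, ← hJ, ← hO]
  simp only [Finset.mul_sum, Finset.sum_add_distrib, mul_add]

/-! ## §2 ★★ Monotonicity: the cell sum of the form is bounded by the form in the atoms' bounds -/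

/-- ★★ **THE CELL KNIT, ABSTRACT FORM**: if every coefficient is `≥ 0` and the cell totals of the atoms are bounded — `Σ_{z,κ,μ} Tg ≤ BTg`, …, `Σ_{z,κ,μ} Eg j ≤ BEg j` (`j < k′`), …,
`Σ_{z,κ} Og i ≤ BOg i` (`i ≤ k′`), … — then `Σ_z Σ_κ` of the per-corner form is at most the same form in the bounds.  (F-6d-3 instantiates: `BTg = L·GRADcell_{k′}`, `BTm = d·MASScell_{k′}`,
`BEg j = d·d·Aᵈ·GRADcell_j`, `BEd j = d·DEFcell_j`, `BOg i = d·GRADcell_i`, … by F-6d-1∕F-6d-2a.) [cite: Balaban1985Averaging, (125)-(126) p.36; Balaban1984PropagatorsI, (1.18)-(1.20) pp.19-20] -/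
theorem sum_sum_linForm_le (k' : ℕ) {dd Wt c₁ c₂ c₃ cL Ld cg cd cO : ℝ} {sw w c1 Cm so cO' : ℕ → ℝ}
    (hdd : 0 ≤ dd) (hWt : 0 ≤ Wt) (hc₁ : 0 ≤ c₁) (hc₂ : 0 ≤ c₂) (hc₃ : 0 ≤ c₃) (hcL : 0 ≤ cL) (hLd : 0 ≤ Ld) (hcg : 0 ≤ cg) (hcd : 0 ≤ cd)
    (hcO : 0 ≤ cO) (hsw : ∀ j, 0 ≤ sw j) (hw : ∀ j, 0 ≤ w j) (hc1 : ∀ j, 0 ≤ c1 j) (hCm : ∀ j, 0 ≤ Cm j) (hso : ∀ i, 0 ≤ so i) (hcO' : ∀ i, 0 ≤ cO' i)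
    (Tg Tm : Z → K → K → ℝ) (Eg Em Ed Eg' Em' Ed' : ℕ → Z → K → K → ℝ) (Og Om Og' Om' : ℕ → Z → K → ℝ)
    {BTg BTm : ℝ} {BEg BEm BEd BEg' BEm' BEd' BOg BOm BOg' BOm' : ℕ → ℝ}
    (hTg : ∑ z : Z, ∑ κ : K, ∑ μ : K, Tg z κ μ ≤ BTg) (hTm : ∑ z : Z, ∑ κ : K, ∑ μ : K, Tm z κ μ ≤ BTm)
    (hEg : ∀ j, j < k' → ∑ z : Z, ∑ κ : K, ∑ μ : K, Eg j z κ μ ≤ BEg j) (hEm : ∀ j, j < k' → ∑ z : Z, ∑ κ : K, ∑ μ : K, Em j z κ μ ≤ BEm j)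
    (hEd : ∀ j, j < k' → ∑ z : Z, ∑ κ : K, ∑ μ : K, Ed j z κ μ ≤ BEd j)
    (hEg' : ∀ j, j < k' → ∑ z : Z, ∑ κ : K, ∑ μ : K, Eg' j z κ μ ≤ BEg' j) (hEm' : ∀ j, j < k' → ∑ z : Z, ∑ κ : K, ∑ μ : K, Em' j z κ μ ≤ BEm' j)
    (hEd' : ∀ j, j < k' → ∑ z : Z, ∑ κ : K, ∑ μ : K, Ed' j z κ μ ≤ BEd' j)
    (hOg : ∀ i, i < k' + 1 → ∑ z : Z, ∑ κ : K, Og i z κ ≤ BOg i) (hOm : ∀ i, i < k' + 1 → ∑ z : Z, ∑ κ : K, Om i z κ ≤ BOm i)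
    (hOg' : ∀ i, i < k' + 1 → ∑ z : Z, ∑ κ : K, Og' i z κ ≤ BOg' i) (hOm' : ∀ i, i < k' + 1 → ∑ z : Z, ∑ κ : K, Om' i z κ ≤ BOm' i) :
    ∑ z : Z, ∑ κ : K,
      3 * (dd * Wt * ∑ μ : K, (c₁ * (c₂ * Tg z κ μ + c₃ * Tm z κ μ))
        + 2 * dd * cL * ∑ j ∈ range k', sw j * w j * ∑ μ : K,
            (c1 j * (Ld * (cg * Eg j z κ μ + Cm j * Em j z κ μ) + cd * Ed j z κ μ)
              + c1 j * (Ld * (cg * Eg' j z κ μ + Cm j * Em' j z κ μ) + cd * Ed' j z κ μ))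
        + 2 * cL * ∑ i ∈ range (k' + 1), so i *
            ((cO * Og i z κ + cO' i * Om i z κ) + (cO * Og' i z κ + cO' i * Om' i z κ)))
    ≤ 3 * (dd * Wt * (c₁ * (c₂ * BTg + c₃ * BTm))
        + 2 * dd * cL * ∑ j ∈ range k', sw j * w j *
            (c1 j * (Ld * (cg * BEg j + Cm j * BEm j) + cd * BEd j)
              + c1 j * (Ld * (cg * BEg' j + Cm j * BEm' j) + cd * BEd' j))
        + 2 * cL * ∑ i ∈ range (k' + 1), so i *
            ((cO * BOg i + cO' i * BOm i) + (cO * BOg' i + cO' i * BOm' i))) := by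
  rw [sum_sum_linForm_eq]
  have h2dd : 0 ≤ 2 * dd * cL := by positivity
  have h2cL : 0 ≤ 2 * cL := by positivity
  refine mul_le_mul_of_nonneg_left (add_le_add (add_le_add ?_ ?_) ?_) (by norm_num)
  · -- top
    exact mul_le_mul_of_nonneg_left (mul_le_mul_of_nonneg_left
      (add_le_add (mul_le_mul_of_nonneg_left hTg hc₂) (mul_le_mul_of_nonneg_left hTm hc₃)) hc₁) (mul_nonneg hdd hWt)
  · -- levels j < k′
    refine mul_le_mul_of_nonneg_left (Finset.sum_le_sum fun j hj => ?_) h2dd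
    have hj' : j < k' := Finset.mem_range.1 hj
    refine mul_le_mul_of_nonneg_left (add_le_add ?_ ?_) (mul_nonneg (hsw j) (hw j))
    · exact mul_le_mul_of_nonneg_left (add_le_add (mul_le_mul_of_nonneg_left
        (add_le_add (mul_le_mul_of_nonneg_left (hEg j hj') hcg) (mul_le_mul_of_nonneg_left (hEm j hj') (hCm j))) hLd)
        (mul_le_mul_of_nonneg_left (hEd j hj') hcd)) (hc1 j)
    · exact mul_le_mul_of_nonneg_left (add_le_add (mul_le_mul_of_nonneg_left
        (add_le_add (mul_le_mul_of_nonneg_left (hEg' j hj') hcg) (mul_le_mul_of_nonneg_left (hEm' j hj') (hCm j))) hLd)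
        (mul_le_mul_of_nonneg_left (hEd' j hj') hcd)) (hc1 j)
  · -- oscillations i ≤ k′
    refine mul_le_mul_of_nonneg_left (Finset.sum_le_sum fun i hi => ?_) h2cL
    have hi' : i < k' + 1 := Finset.mem_range.1 hi
    exact mul_le_mul_of_nonneg_left (add_le_add
      (add_le_add (mul_le_mul_of_nonneg_left (hOg i hi') hcO) (mul_le_mul_of_nonneg_left (hOm i hi') (hcO' i)))
      (add_le_add (mul_le_mul_of_nonneg_left (hOg' i hi') hcO) (mul_le_mul_of_nonneg_left (hOm' i hi') (hcO' i)))) (hso i)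

end Summit.QuantumFields.YangMills.Theorems.Prop7CornerCombCellKnitAbstract

end
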